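import Mathlib
import HarnessLib
import HarnessLib.Audit
import Summits.NavierStokesRegularity.Statement
import Literature.Analysis.FluidPDE.ClassicalSolution
import Literature.Analysis.FluidPDE.LerayHopf
import Literature.Analysis.FluidPDE.VectorCalculus
import Literature.Analysis.FluidPDE.NSWave0
import Literature.Analysis.FluidPDE.OctahedralSymmetry
import HarnessLib.Audit.Status.Attr

/-!
Route: ConeTipCollapse

# Route ConeTipCollapse — Cone-tip collapse — a quasi-steady smooth Euler core with an interacting
log-periodic conical tail, collapsing at the Leray length, refutes Clay (A)

REFUTATION route (closes `¬ NavierStokesRegularity`). It suffices to show X = CollapsingResolver ∧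
SkeletonRealisation:
(C1) there is a COLLAPSING RESOLVER — exponents 1 < a < 3/2, a ratio l₀ > 1, a C¹ steady Euler cone
(h,P) on ℝ³∖0 that is
l₀-discretely self-similar of degree −a (log-periodic), chiral-octahedrally (O-)equivariant and
interacting (h vanishes on no open
set), a C^∞ O-equivariant steady Euler flow (Q,Φ) on ℝ³ with conical tail h (|Q−h| + |y||∇(Q−h)| ≤
C|y|^(−a−δ)), and a first-order
collapse corrector (b < 0, W, q): (Q·∇)W + (W·∇)Q + ∇q = ΔQ + b(aQ + (y·∇)Q); and (C3) every such
skeleton is REALISED: some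
classical Leray–Hopf solution from a smooth rapidly decaying datum is maximal with finite life-span
T, O-equivariant, and
λ(t)^a u(t, λ(t)y) → Q(y) locally uniformly as t ↑ T with λ(t) = (2|b|ν(T−t))^(1/2). With the PROVED
support ClayUniqueness
(stmt-0153) the in-tree blow-up assembly gives ¬(Clay A). Realises sketch
mwave/log-periodic-cone-tip-collapse (reader PASS 4/3/4/4); no idea card.
Lean: `(∃ (a l₀ : ℝ) (h : EuclideanSpace ℝ (Fin 3) → EuclideanSpace ℝ (Fin 3)) (P : EuclideanSpace ℝ
(Fin 3) → ℝ) (Q : EuclideanSpace ℝ (Fin 3) → EuclideanSpace ℝ (Fin 3)) (Φ : EuclideanSpace ℝ (Fin 3)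
→ ℝ) (b : ℝ) (W : EuclideanSpace ℝ (Fin 3) → EuclideanSpace ℝ (Fin 3)) (q : EuclideanSpace ℝ (Fin 3)
→ ℝ), 1 < a ∧ a < 3 / 2 ∧ 1 < l₀ ∧ ContDiffOn ℝ 1 h {x : EuclideanSpace ℝ (Fin 3) | x ≠ 0} ∧
ContDiffOn ℝ 1 P {x : EuclideanSpace ℝ (Fin 3) | x ≠ 0} ∧ (∀ x : EuclideanSpace ℝ (Fin 3), x ≠ 0 → h
(l₀ • x) = (l₀ ^ (-a)) • h x) ∧ (∀ x : EuclideanSpace ℝ (Fin 3), x ≠ 0 → P (l₀ • x) = l₀ ^ (-(2 *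
a)) * P x) ∧ (∀ x : EuclideanSpace ℝ (Fin 3), x ≠ 0 →
Literature.Analysis.FluidPDE.VectorCalculus.divergence h x = 0) ∧ (∀ x : EuclideanSpace ℝ (Fin 3), x
≠ 0 → Literature.Analysis.FluidPDE.convect h h x + gradient P x = 0) ∧ (∀ g : EuclideanSpace ℝ (Fin
3) ≃ₗᵢ[ℝ] EuclideanSpace ℝ (Fin 3), Literature.Analysis.FluidPDE.IsOctahedralIsometry g →
LinearMap.det (g.toLinearEquiv : EuclideanSpace ℝ (Fin 3) →ₗ[ℝ] EuclideanSpace ℝ (Fin 3)) = 1 → ∀ x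
: EuclideanSpace ℝ (Fin 3), h (g x) = g (h x) ∧ P (g x) = P x) ∧ (∀ s : Set (EuclideanSpace ℝ (Fin
3)), IsOpen s → s.Nonempty → ∃ x ∈ s, x ≠ 0 ∧ h x ≠ 0) ∧ ContDiff ℝ (⊤ : ℕ∞) Q ∧ ContDiff ℝ (⊤ : ℕ∞)
Φ ∧ Literature.Analysis.FluidPDE.VectorCalculus.IsDivFree Q ∧ (∀ y : EuclideanSpace ℝ (Fin 3),
Literature.Analysis.FluidPDE.convect Q Q y + gradient Φ y = 0) ∧ (∀ g : EuclideanSpace ℝ (Fin 3)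
≃ₗᵢ[ℝ] EuclideanSpace ℝ (Fin 3), Literature.Analysis.FluidPDE.IsOctahedralIsometry g → LinearMap.det
(g.toLinearEquiv : EuclideanSpace ℝ (Fin 3) →ₗ[ℝ] EuclideanSpace ℝ (Fin 3)) = 1 → ∀ y :
EuclideanSpace ℝ (Fin 3), Q (g y) = g (Q y) ∧ Φ (g y) = Φ y) ∧ (∀ s : Set (EuclideanSpace ℝ (Fin
3)), IsOpen s → s.Nonempty → ∃ y ∈ s, Q y ≠ 0) ∧ (∃ C δ : ℝ, 0 < δ ∧ ∀ y : EuclideanSpace ℝ (Fin 3),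
1 ≤ ‖y‖ → ‖Q y - h y‖ + ‖y‖ * ‖fderiv ℝ Q y - fderiv ℝ h y‖ ≤ C * ‖y‖ ^ (-a - δ)) ∧ b < 0 ∧ ContDiff
ℝ (⊤ : ℕ∞) W ∧ ContDiff ℝ (⊤ : ℕ∞) q ∧ Literature.Analysis.FluidPDE.VectorCalculus.IsDivFree W ∧ (∀
y : EuclideanSpace ℝ (Fin 3), Literature.Analysis.FluidPDE.convect Q W y +
Literature.Analysis.FluidPDE.convect W Q y + gradient q y = Laplacian.laplacian Q y + b • (a • Q y +
(fderiv ℝ Q y) y))) ∧ (∀ (a l₀ : ℝ) (h : EuclideanSpace ℝ (Fin 3) → EuclideanSpace ℝ (Fin 3)) (P :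
EuclideanSpace ℝ (Fin 3) → ℝ) (Q : EuclideanSpace ℝ (Fin 3) → EuclideanSpace ℝ (Fin 3)) (Φ :
EuclideanSpace ℝ (Fin 3) → ℝ) (b : ℝ) (W : EuclideanSpace ℝ (Fin 3) → EuclideanSpace ℝ (Fin 3)) (q :
EuclideanSpace ℝ (Fin 3) → ℝ), (1 < a ∧ a < 3 / 2 ∧ 1 < l₀ ∧ ContDiffOn ℝ 1 h {x : EuclideanSpace ℝ
(Fin 3) | x ≠ 0} ∧ ContDiffOn ℝ 1 P {x : EuclideanSpace ℝ (Fin 3) | x ≠ 0} ∧ (∀ x : EuclideanSpace ℝ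
(Fin 3), x ≠ 0 → h (l₀ • x) = (l₀ ^ (-a)) • h x) ∧ (∀ x : EuclideanSpace ℝ (Fin 3), x ≠ 0 → P (l₀ •
x) = l₀ ^ (-(2 * a)) * P x) ∧ (∀ x : EuclideanSpace ℝ (Fin 3), x ≠ 0 →
Literature.Analysis.FluidPDE.VectorCalculus.divergence h x = 0) ∧ (∀ x : EuclideanSpace ℝ (Fin 3), x
≠ 0 → Literature.Analysis.FluidPDE.convect h h x + gradient P x = 0) ∧ (∀ g : EuclideanSpace ℝ (Fin
3) ≃ₗᵢ[ℝ] EuclideanSpace ℝ (Fin 3), Literature.Analysis.FluidPDE.IsOctahedralIsometry g →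
LinearMap.det (g.toLinearEquiv : EuclideanSpace ℝ (Fin 3) →ₗ[ℝ] EuclideanSpace ℝ (Fin 3)) = 1 → ∀ x
: EuclideanSpace ℝ (Fin 3), h (g x) = g (h x) ∧ P (g x) = P x) ∧ (∀ s : Set (EuclideanSpace ℝ (Fin
3)), IsOpen s → s.Nonempty → ∃ x ∈ s, x ≠ 0 ∧ h x ≠ 0) ∧ ContDiff ℝ (⊤ : ℕ∞) Q ∧ ContDiff ℝ (⊤ : ℕ∞)
Φ ∧ Literature.Analysis.FluidPDE.VectorCalculus.IsDivFree Q ∧ (∀ y : EuclideanSpace ℝ (Fin 3),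
Literature.Analysis.FluidPDE.convect Q Q y + gradient Φ y = 0) ∧ (∀ g : EuclideanSpace ℝ (Fin 3)
≃ₗᵢ[ℝ] EuclideanSpace ℝ (Fin 3), Literature.Analysis.FluidPDE.IsOctahedralIsometry g → LinearMap.det
(g.toLinearEquiv : EuclideanSpace ℝ (Fin 3) →ₗ[ℝ] EuclideanSpace ℝ (Fin 3)) = 1 → ∀ y :
EuclideanSpace ℝ (Fin 3), Q (g y) = g (Q y) ∧ Φ (g y) = Φ y) ∧ (∀ s : Set (EuclideanSpace ℝ (Fin
3)), IsOpen s → s.Nonempty → ∃ y ∈ s, Q y ≠ 0) ∧ (∃ C δ : ℝ, 0 < δ ∧ ∀ y : EuclideanSpace ℝ (Fin 3),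
1 ≤ ‖y‖ → ‖Q y - h y‖ + ‖y‖ * ‖fderiv ℝ Q y - fderiv ℝ h y‖ ≤ C * ‖y‖ ^ (-a - δ)) ∧ b < 0 ∧ ContDiff
ℝ (⊤ : ℕ∞) W ∧ ContDiff ℝ (⊤ : ℕ∞) q ∧ Literature.Analysis.FluidPDE.VectorCalculus.IsDivFree W ∧ (∀
y : EuclideanSpace ℝ (Fin 3), Literature.Analysis.FluidPDE.convect Q W y +
Literature.Analysis.FluidPDE.convect W Q y + gradient q y = Laplacian.laplacian Q y + b • (a • Q y +
(fderiv ℝ Q y) y))) → ∃ ν : ℝ, 0 < ν ∧ ∃ T : ℝ, 0 < T ∧ ∃ (u : ℝ → EuclideanSpace ℝ (Fin 3) →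
EuclideanSpace ℝ (Fin 3)) (p : ℝ → EuclideanSpace ℝ (Fin 3) → ℝ),
Literature.Analysis.FluidPDE.IsMaximalSmoothSolution ν 0 u p T ∧
Literature.Analysis.FluidPDE.IsLerayHopfOn T ν 0 (u 0) u ∧
Literature.Analysis.FluidPDE.HasRapidSpatialDecay (u 0) ∧ (∀ t ∈ Set.Ico (0 : ℝ) T, ∀ g :
EuclideanSpace ℝ (Fin 3) ≃ₗᵢ[ℝ] EuclideanSpace ℝ (Fin 3),
Literature.Analysis.FluidPDE.IsOctahedralIsometry g → LinearMap.det (g.toLinearEquiv :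
EuclideanSpace ℝ (Fin 3) →ₗ[ℝ] EuclideanSpace ℝ (Fin 3)) = 1 → ∀ x : EuclideanSpace ℝ (Fin 3), u t
(g x) = g (u t x)) ∧ TendstoLocallyUniformly (fun (t : ℝ) (y : EuclideanSpace ℝ (Fin 3)) =>
(Real.sqrt (2 * |b| * ν * (T - t)) ^ a) • u t ((Real.sqrt (2 * |b| * ν * (T - t))) • y)) Q
(nhdsWithin T (Set.Iio T)))`

## Assembly
Pure logic, certified (Sketch.lean + glue.lean, lean check rc 0, 0 sorry; the gate's
`#h21_check_closes` verdict ok/negative): from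
h₂ : InteractingLogPeriodicCone and hR : ConeToResolver get h₁ : CollapsingResolver; take its
skeleton (a, l₀, h, P, Q, Φ, b, W, q);
h₃ : SkeletonRealisation applied to it gives ν > 0, T > 0, (u,p) maximal smooth, Leray–Hopf from u
0, u 0 rapidly decaying (forget
equivariance and the profile clause); Clay (A) applied to the datum u 0 gives a global smooth
bounded-energy solution, ClayUniqueness
glues it to u on [0,T), and its restriction to [0,T+1) is a smooth extension past T, contradicting
maximality (the argument of the
proved Literature.NS.blowup_assembly, inlined). Deciding theorem `theorem closes (h₂ :
InteractingLogPeriodicCone) (hR : ConeToResolver)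
(h₃ : SkeletonRealisation) (hU : ClayUniqueness) : ¬ _root_.NavierStokesRegularity`, opened with
--refutation; it derives
CollapsingResolver and the Assembly item inline (`have h₁ … have hA : Assembly := …; exact hA h₁ h₃
hU`), so all six items are in the
cone of `closes` (BC6 6/6). Load-bearing OPEN binders: InteractingLogPeriodicCone, ConeToResolver,
SkeletonRealisation (BC1 cone = 3);
CollapsingResolver is the derived deciding node; ClayUniqueness is proved (stmt-0153).

Rationale: WHY THIS LINE. Steady Euler has a two-parameter scaling group Q ↦ μQ(·/λ); along the subgroup μ =
λ^(−a), 1 < a < 3/2, a smooth steady Euler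
core whose tangent flow at infinity is a degree-(−a) cone can shrink quasi-statically, u ≈
λ(t)^(−a)Q(x/λ(t)), with the core
Reynolds number λ^(1−a)/ν → ∞ (inviscid core) while the collapse clock is viscous: the O(1/Re)
equation of the ansatz is the
linear corrector equation (★★) with b = λλ̇/ν, whose solvability conditions on every compact
Bernoulli torus of Q (cokernel
f(B_Q)Q, g(B_Q)curl Q, Arnold's structure theorem) say that viscous energy loss and flux change per
torus equal those of
self-similar shrinking — Kelvin's theorem plus viscosity fixes γ = 1/2 and the amplitude exponent
a/2 ∈ (1/2,3/4), Type II by a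
full power, ‖u‖_(L³) ≍ λ^(1−a) → ∞, one singular point, locally finite energy iff a < 3/2. The cone
must be log-periodic (the
homogeneous analytic case is empty for 1 < a < 2, internal x3 Thm A; Shvydkoy arXiv:1510.03378
conjectures no C¹ homogeneous
solutions for α > −1) and of finite symmetry (swirl / ω_θ/r maximum principles kill axisymmetric
skeletons for a > 1), hence O.
Imported: structure theory of 3-D steady Euler (Arnold; Grad's conjecture side, arXiv:2007.09103
Conj. 1, arXiv:2305.05987 p.12),
Voigt–MHD magnetic relaxation as the engine for non-symmetric equilibria (arXiv:2208.11109 Thms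
1.1–1.2), modulation /
threshold blow-up technology (arXiv:1912.11009, arXiv:1702.05801). Versus the ledger: this is
verbatim the successor object (2b)
named by the kill memo of the refuted AdiabaticEddy.CorrectorSolvable (negatives stmt-1429: compact
support × diffusion, UCP) —
the compact eddy is replaced by a smooth core with an interacting conical tail (no zero open set, so
the Carleman/UCP kill and
the flatness kill of the interior-corrector no-go have nothing to start from), the per-torus laws
are built into C1, and the
amplitude window α = a/2 is explained rather than posited; no open route uses a conical steady-Euler
skeleton or the
two-parameter steady scaling (nearest open: DSolutionBubble = viscous core, LandauTail = a = 1).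

RANKED CRUXES. #2 CollapsingResolver (crux) — (deciding ∃-package; reached in `closes` as
ConeToResolver applied to InteractingLogPeriodicCone, and provable directly) ∃ a ∈ (1,3/2), l₀ > 1,
a C¹ steady Euler cone (h,P) on ℝ³∖0 — div h = 0 and (h·∇)h + ∇P = 0 off 0, h(l₀x) = l₀^(−a)h(x),
P(l₀x) = l₀^(−2a)P(x), O-equivariant (h(gx) = g h(x), P(gx) = P(x) for the 24 signed-permutation
rotations), interacting (every nonempty open set contains x ≠ 0 with h x ≠ 0) — a C^∞ steady Euler
flow (Q,Φ) on ℝ³ (div Q = 0, (Q·∇)Q + ∇Φ = 0), O-equivariant, nonzero somewhere in every nonempty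
open set, with conical tail ‖Q y − h y‖ + ‖y‖·‖DQ y − Dh y‖ ≤ C‖y‖^(−a−δ) for ‖y‖ ≥ 1 (some C, some
δ > 0), and a collapse corrector b < 0, C^∞ W (div W = 0), C^∞ q with (Q·∇)W + (W·∇)Q + ∇q = ΔQ +
b(aQ + (DQ)y) on ℝ³. Sketch item C1. [difficulty: open-problem] (why it might fail: Q must be a
smooth NON-symmetric equilibrium with compact invariant Bernoulli tori (anti-Grad: arXiv:2007.09103
Conj.1, arXiv:2305.05987 p.12 "unknown"); even granting Q the per-torus energy/flux laws may force b
> 0 (Oseen shadow); and the cone may not exist (C2).) [arXiv:1510.03378, arXiv:2305.05987,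
arXiv:2007.09103, arXiv:2208.11109, arXiv:2606.13462, Gavrilov2019,
Summits/NavierStokesRegularity/NavierStokesRegularity/Cruxes/CorrectorSolvable/KillMemo-stokes-carleman.md]
#3 InteractingLogPeriodicCone (crux) — (the wall; C1 ⇒ C2 by projection; staffed on its own because
it is CAP-searchable and its negation is a printable theorem) ∃ a ∈ (1,3/2), l₀ > 1 and a C¹ steady
Euler flow (h,P) on ℝ³∖0, l₀-discretely self-similar of degrees (−a, −2a), O-equivariant,
interacting (h vanishes identically on no nonempty open set). Equivalent to a nontrivial
O-equivariant C¹ solution of the reduced first-order system on the compact quotient S²×(ℝ/(log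
l₀)ℤ). Sketch item C2. [difficulty: XL] (why it might fail: Shvydkoy conjectures NO nontrivial C¹
homogeneous solutions for α > −1 (arXiv:1510.03378 p.4) and proves none axisymmetric for 0 < α < 2
(Prop 5.1); DSS only removes Poincaré–Hopf forcing — measure preservation + negative mean pressure
may still give a no-go; all numerics so far null.) [arXiv:1510.03378, arXiv:2305.05987,
doi:10.1007/s00205-013-0630-z, arXiv:1409.4322, arXiv:2208.11109,
Literature.Analysis.FluidPDE.shvydkoy2018_prop51_noAxisymmetric]
#4 ConeToResolver (crux) — (the desingularisation-plus-corrector step in its weakest, existential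
form; binder of `closes`) if SOME interacting O-equivariant log-periodic steady Euler cone exists in
the window, then some such cone is the tangent flow at infinity of a C^∞ O-equivariant steady Euler
flow (Q,Φ) on ℝ³ (nonzero on every nonempty open set, conical tail of order ‖y‖^(−a−δ)) that admits
a first-order collapse corrector (b < 0, W, q) — i.e. InteractingLogPeriodicCone →
CollapsingResolver. The birth skeleton separates it into ResolveOnly (equivariant desingularisation
of the cone tip: Voigt–MHD magnetic relaxation from the truncated cone, arXiv:2208.11109) and
CorrectOnly (solvability of (★★): per-torus energy/flux laws on the compact Bernoulli tori, Arnold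
structure + hyperbolic axis chains); both are ∀-form STUBS, never items. [deps:
InteractingLogPeriodicCone, CollapsingResolver] [difficulty: open-problem] (why it might fail:
anti-Grad: a smooth NON-symmetric steady Euler flow with a region of compact invariant tori may not
exist at all (arXiv:2007.09103 Conj. 1; arXiv:2305.05987 p.12), relaxation may only reach non-smooth
limits (arXiv:2208.11109 gives H¹/W^(k,p) limits, not C^∞), and the per-torus laws may force b > 0.)
[arXiv:2208.11109, arXiv:2007.09103, arXiv:2305.05987, arXiv:2606.13462, ArnoldKhesin1998,
Summits/NavierStokesRegularity/NavierStokesRegularity/Cruxes/CorrectorSolvable/KillMemo-stokes-carleman.md]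
#5 SkeletonRealisation (crux) — (the NS construction given the skeleton; hardest technically,
pointless before C1) for EVERY skeleton (a, l₀, h, P, Q, Φ, b, W, q) satisfying the C1 clauses there
are ν > 0, T > 0 and a classical solution (u,p) of unforced Navier–Stokes on ℝ³×[0,T) which is
MAXIMAL (IsMaximalSmoothSolution ν 0 u p T), Leray–Hopf on [0,T] from its own datum, with u(0)
rapidly decaying, O-equivariant for every t ∈ [0,T), and such that λ(t)^a • u t (λ(t) • y) → Q(y)
locally uniformly in y as t ↑ T, λ(t) = √(2|b|ν(T−t)) (three-zone quasi-steady modulation: inner Q +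
εW, ε = νλ^(a−1) → 0; cone zone; β_a-similarity phase-slip layer at |x| ≍ (T−t)^(1/(1+a)); Schwartz
truncation; threshold control of the growing family of fast instabilities (H_spec)). Sketch item C3;
conclusion block verbatim the shape of AdiabaticEddy.FrozenEddyCollapse /
Literature.NS.blowup_assembly. [deps: CollapsingResolver] [difficulty: open-problem] (why it might
fail: the number of unstable directions N(λ) of the linearisation grows without bound as t ↑ T
(hyperbolic stagnation chains: Friedlander–Vishik essential spectrum), defeating epoch-by-epoch
threshold selection; the β_a-similarity layer may radiate growing modes inward; pressure
non-locality across zones.) [arXiv:1912.11009, arXiv:1702.05801, arXiv:0901.4286, arXiv:1901.09426,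
arXiv:2304.04045, arXiv:2602.17570, FriedlanderVishik1991, BealeKatoMajda1984]
#9 ClayUniqueness (support) — (PROVED in tree: stmt-NavierStokesRegularity-0153,
`Summit.NavierStokesRegularity.NavierStokesRegularity.Theorems.blowup_clay_uniqueness` /
`adiabaticEddy_clayUniqueness_proof`; shared verbatim with Blowup.X5b, AdiabaticEddy.ClayUniqueness,
MirrorChamber.ClayUniqueness) a Fefferman class-(A) solution from a rapidly decaying datum agrees on
[0,T) with any classical Leray–Hopf solution from the same datum. Binder of `closes`; closed on
arrival. [difficulty: provable-now] [Tao2013LocalisationCompactness, EscauriazaSereginSverak2003,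
Summits/NavierStokesRegularity/NavierStokesRegularity/Theorems/AdiabaticEddyClayUniquenessCore.lean]

TWO-LAYER PLAN. Registered birth skeletons (BC3; stubs are ∀-form and never items — a refuted ∀-stub
kills a line, not the route):
CollapsingResolver ⇐ stub_cone (= InteractingLogPeriodicCone) → stub_desing (ResolveOnly: every
admissible cone is the tangent flow at
infinity of an O-equivariant smooth steady Euler flow with conical tail) → stub_corrector
(CorrectOnly: every such resolved skeleton
admits a collapse corrector with b < 0) → CollapsingResolver; ConeToResolver ⇐ stub_desing →
stub_corrector → ConeToResolver;
InteractingLogPeriodicCone ⇐ stub_variational (the a = 3/2 energy-critical cone by equivariant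
relaxation on S²×S¹) → stub_continuation
(continuation in a into (1,3/2), CAP) → InteractingLogPeriodicCone; SkeletonRealisation ⇐
stub_coneCollapse (infinite-energy collapse of
the untruncated skeleton in the local-energy class) → stub_truncation (Schwartz truncation bridge) →
SkeletonRealisation. Glued splits at
route level only in tenure, after a crux closes.

KILL CRITERIA. ¬CollapsingResolver proved as a theorem ("no quasi-statically collapsing inviscid
core with a > 1": e.g. a sign clash between the
per-torus energy and flux laws, or their core-line limit ∮ t̂·(ΔQ + b(aQ + (y·∇)Q)) w ds = 0,
against the local normal form of
steady Euler at an elliptic closed line) closes the route `refuted:CollapsingResolver` and hands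
NoTypeII (stmt-0056) a named
excluded class. ¬InteractingLogPeriodicCone in the O-class (x3 identities on S²×S¹ extended to Λ >
0) closes it
`refuted:InteractingLogPeriodicCone` (and answers Abe's printed question negatively in the DSS
class). A proof of
TypeTwoEternal.PaceCell, VorticityPace's PACE crux, AffineBernoulli.ClosedWindowSkeleton or any
"Type II ⇒ self-similar Euler
profile" crux (VortexLineClock.TypeIIWindowCore) kills SkeletonRealisation; conversely a realised C3
refutes each of those.
Mooted by: a proof of NavierStokesRegularity (any positive route).

NOT DECOMPOSED YET. The tameness data the desingularisation needs (hyperbolic axis chains, regular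
Bernoulli leaves off a null set), the per-torus
ODE families, the weighted helicity lower bound for relaxation on the quotient, the phase-slip
profile of the β_a-similarity
layer, (H_spec) as a typed spectral statement, constants (a, l₀, δ, b stay existential — typing
checklist 4c(iv)) — all layer-2,
after a crux closes. No third layer ever: lemmas ride with --supports.

CHEAPEST FALSIFIER. Derive the per-torus laws ∫_(B_Q>c) Q·(ΔQ + bΛQ) = 0 = ∫_(B_Q>c) curl Q·(ΔQ +
bΛQ) (ΛQ = aQ + (y·∇)Q) and their limit at an
elliptic core line C₀ of the Bernoulli foliation, and test the sign of b they force against the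
local normal form of steady Euler
at an elliptic closed streamline–vortex line (paper-and-pencil, one refuter-day; a sign clash
forcing b > 0 kills C1 outright —
the 2-D shadow is the Oseen vortex, b > 0). Second cheapest: run x3's integral identities (∫_M f =
0, ∫ fHⁿ = 0, 2a∫_M p =
(2−2a)∫f² − ∫|v|² < 0) against "a vortex core is a pressure minimum" on the 6+8 axis cells of the
O-quotient toward
¬InteractingLogPeriodicCone. Not runnable as a lookup/kit job this session (no candidate object
exists; the 2001 numerics were null).

NUMBERS. a ∈ (1, 3/2) (core Reynolds number λ^(1−a)/ν → ∞ iff a > 1; local energy |x|^(−2a)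
integrable and dissipation νλ^(1−2a)
time-integrable iff a < 3/2); amplitude ‖u(t)‖_∞ ≍ (T−t)^(−a/2), a/2 ∈ (1/2, 3/4) = the
AdiabaticEddy window; γ = 1/2 (Leray
length λ = (2|b|ν(T−t))^(1/2)); similarity-zone exponent β_a = 1/(1+a) ∈ (2/5, 1/2) (CIV
arXiv:2602.17570: finite energy ⇒ γ ≥ 2/5);
‖u(t)‖_(L³) ≍ λ^(1−a) → ∞ (Seregin); ∫‖u‖²_∞ dt = ∞ iff a ≥ 1 (Prodi–Serrin L²_t L^∞_x respected
strictly); Chae–Shvydkoy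
self-similar-Euler exclusion window N/p < α ≤ N/2 contains a ∈ (1,3/2)
(doi:10.1007/s00205-013-0630-z).

DEFINITION REQUESTS. IsLogPeriodicSteadyEulerCone (a l₀ : ℝ) (h : ℝ³ → ℝ³) (P : ℝ³ → ℝ) : Prop
(topic Literature/Analysis/FluidPDE): the first nine
clauses of InteractingLogPeriodicCone (C¹ off 0, DSS of degrees (−a,−2a) with ratio l₀, div-free and
steady Euler off 0) — would
make C1/C2/C3 readable and dedupable; filed with `ledger workitem add --kind definition` after open.
Optional: bernoulliHead Q Φ :=
fun y => Φ y + ‖Q y‖²/2 (inline). Nothing else is missing from Mathlib/tree for the STATEMENTS.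

Novelty: Searches (2026-08-17, this seat + the sketch seat): lit search --hybrid "homogeneous stationary
Euler solutions negative degree non-axisymmetric existence Shvydkoy Abe" (10 textbook rows, noise);
lit search '"homogeneous solutions" stationary Euler Shvydkoy' --source local (12 held papers, all
bibliography hits: arXiv:1704.08730, 2509.07243, 2410.11170, 1811.01089, 2007.09103 …; nothing with
Λ > 0 cones); lit read arXiv:1510.03378 --grep (p.4 conjecture, p.11 Prop 5.1)
[corpus:arxiv-1510.03378 p.4, p.11]; lit read arXiv:2305.05987 --grep asymmetric
[corpus:arxiv-2305.05987 p.12]; lit read arXiv:2007.09103 --grep Grad [corpus:arxiv-2007.09103 p.7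
Conj. 1]; lit galaxy search --star all "homogeneous stationary Euler|homogeneous solutions to the 3D
Euler|homogeneous Euler flows" (1 row: [galaxy:pdf:1095072167710678100] = arXiv:2410.11170,
(−1)-homogeneous stationary NS, removable singularity — not our object); lit galaxy search --star
all "Grad's conjecture|Grad conjecture|nested flux surfaces" (20 rows, plasma books +
[galaxy:pdf:-1904856479487040520] = arXiv:2007.09103); lit vsearch "blow-up construction with
infinitely many unstable directions …" (8 dynamical-systems books, none relevant); lit galaxy search
--star all "infinitely many unstable directions|infinite codimension|countable codimension" (16
rows, none on blow-up constructions); sketch seat (same day): lit search on Constantin–Pasqualotto /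
Grad conjecture / Chae Liouville, lit read of arXiv:1510.03378, 2606.13462, 2  [refs: 1704.08730, 1510.03378, 2305.05987, 2007.09103, 2410.11170, 0901.4286, 1901.09426, 1912.11009, arxiv-1510.03378, arxiv-2305.05987, arxiv-2007.09103]

Barriers (technique_class: blowup-construction, quasi-steady-modulation, steady-Euler): - technique_class: blowup-construction, quasi-steady-modulation, steady-Euler-skeleton,
conical-infinite-energy-tail, octahedral-symmetry, threshold-stability
- Literature.Barriers.NavierStokesRegularity.LeraySelfSimilarBlowupExclusion: outside — no Leray
profile: the NS amplitude is (T−t)^(−a/2) with a/2 > 1/2, so in Leray variables the rescaled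
solution diverges and the NRŠ/Tsai profile theorems and Chae2007-type asymptotically-self-similar
exclusions (convergence in L^p, p ≥ 3) do not quantify over this scenario; the steady objects h, Q
solve Euler, not Leray's system [tree docstring: NecasRuzickaSverak1996 Thm 1, Tsai1998 Thms 1–2,
evasions_known].
- Literature.Barriers.NavierStokesRegularity.CriticalNormBlowupNecessity: inside its hypotheses and
satisfied, not contradicted — ‖u(t)‖_(L³) ≍ λ^(1−a) → ∞ (a > 1), Tao's triple-log rate trivially met
[tree: ess_endpoint, seregin_L3_blowup, tao_L3_blowup_rate].
- Literature.Barriers.NavierStokesRegularity.SingularSetDimensionBound: satisfied — singular set =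
one point (0,T) [tree: ckn_partial_regularity].
- Literature.Barriers.NavierStokesRegularity.AxisymmetricTypeIExclusion: outside twice — the
skeleton is not axisymmetric (O-equivariant and, by the swirl / ω_θ/r maximum principles,
necessarily non-axisymmetric for a > 1) and the rate is Type II.
- Literature.Barriers.NavierStokesRegularity.NearOneDssTypeIExclusion: outside — not a backward-DSS
Type-I scenario (the NS solution is not discretely self-similar in space-time; onl

sub-problem: NavierStokesRegularity · status: draft · opened planner-type-9c17c6396d-0 2026-08-17T18:14:56Z · rev 0 · ledger route-NavierStokesRegularity-ConeTipCollapse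
GENERATED by the gate from the ledger (D-0016/17). Provers cite these decls: `theorem foo : Summit.NavierStokesRegularity.NavierStokesRegularity.Theses.ConeTipCollapse.<Decl> := …` in Summits/NavierStokesRegularity/NavierStokesRegularity/Theorems/<Name>.lean.
-/

namespace Summit.NavierStokesRegularity.NavierStokesRegularity.Theses.ConeTipCollapse

open scoped BigOperators Topology Manifold Classical MeasureTheory ProbabilityTheory Matrix InnerProductSpace ComplexConjugate ContinuousMap
open Filter Set Function TopologicalSpace MeasureTheory

attribute [summit_statement] _root_.NavierStokesRegularity

open Literature.NS

/-- item stmt-NavierStokesRegularity-19061 · crux · rank 2 · open · by planner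
why it might fail: Q must be a smooth NON-symmetric equilibrium with compact invariant Bernoulli tori (anti-Grad: arXiv:2007.09103 Conj.1, arXiv:2305.05987 p.12 "unknown"); even granting Q the per-torus energy/flux laws may force b > 0 (Oseen shadow); and the cone may not exist (C2).
sources: arXiv:1510.03378, arXiv:2305.05987, arXiv:2007.09103, arXiv:2208.11109, arXiv:2606.13462, Gavrilov2019
[crux] (deciding ∃-package; reached in `closes` as ConeToResolver applied to
InteractingLogPeriodicCone, and provable directly) ∃ a ∈ (1,3/2), l₀ > 1, a C¹ steady Euler cone
(h,P) on ℝ³∖0 — div h = 0 and (h·∇)h + ∇P = 0 off 0, h(l₀x) = l₀^(−a)h(x), P(l₀x) = l₀^(−2a)P(x),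
O-equivariant (h(gx) = g h(x), P(gx) = P(x) for the 24 signed-permutation rotations), interacting
(every nonempty open set contains x ≠ 0 with h x ≠ 0) — a C^∞ steady Euler flow (Q,Φ) on ℝ³ (div Q =
0, (Q·∇)Q + ∇Φ = 0), O-equivariant, nonzero somewhere in every nonempty open set, with conical tail
‖Q y − h y‖ + ‖y‖·‖DQ y − Dh y‖ ≤ C‖y‖^(−a−δ) for ‖y‖ ≥ 1 (some C, some δ > 0), and a collapse
corrector b < 0, C^∞ W (div W = 0), C^∞ q with (Q·∇)W + (W·∇)Q + ∇q = ΔQ + b(aQ + (DQ)y) on ℝ³.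
Sketch item C1. [difficulty: open-problem] -/
@[route_item "route-NavierStokesRegularity-ConeTipCollapse"]
def CollapsingResolver : Prop :=
  ∃ (a l₀ : ℝ) (h : EuclideanSpace ℝ (Fin 3) → EuclideanSpace ℝ (Fin 3)) (P : EuclideanSpace ℝ (Fin 3) → ℝ) (Q : EuclideanSpace ℝ (Fin 3) → EuclideanSpace ℝ (Fin 3)) (Φ : EuclideanSpace ℝ (Fin 3) → ℝ) (b : ℝ) (W : EuclideanSpace ℝ (Fin 3) → EuclideanSpace ℝ (Fin 3)) (q : EuclideanSpace ℝ (Fin 3) → ℝ), 1 < a ∧ a < 3 / 2 ∧ 1 < l₀ ∧ ContDiffOn ℝ 1 h {x : EuclideanSpace ℝ (Fin 3) | x ≠ 0} ∧ ContDiffOn ℝ 1 P {x : EuclideanSpace ℝ (Fin 3) | x ≠ 0} ∧ (∀ x : EuclideanSpace ℝ (Fin 3), x ≠ 0 → h (l₀ • x) = (l₀ ^ (-a)) • h x) ∧ (∀ x : EuclideanSpace ℝ (Fin 3), x ≠ 0 → P (l₀ • x) = l₀ ^ (-(2 * a)) * P x) ∧ (∀ x : EuclideanSpace ℝ (Fin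 3), x ≠ 0 → Literature.Analysis.FluidPDE.VectorCalculus.divergence h x = 0) ∧ (∀ x : EuclideanSpace ℝ (Fin 3), x ≠ 0 → Literature.Analysis.FluidPDE.convect h h x + gradient P x = 0) ∧ (∀ g : EuclideanSpace ℝ (Fin 3) ≃ₗᵢ[ℝ] EuclideanSpace ℝ (Fin 3), Literature.Analysis.FluidPDE.IsOctahedralIsometry g → LinearMap.det (g.toLinearEquiv : EuclideanSpace ℝ (Fin 3) →ₗ[ℝ] EuclideanSpace ℝ (Fin 3)) = 1 → ∀ x : EuclideanSpace ℝ (Fin 3), h (g x) = g (h x) ∧ P (g x) = P x) ∧ (∀ s : Set (EuclideanSpace ℝ (Fin 3)), IsOpen s → s.Nonempty → ∃ x ∈ s, x ≠ 0 ∧ h x ≠ 0) ∧ ContDiff ℝ (⊤ : ℕ∞) Q ∧ ContDiff ℝ (⊤ : ℕ∞) Φ ∧ Literature.Analysis.FluidPDE.VectorCalculus.IsDivFree Q ∧ (∀ y : EuclideanSpace ℝ (Fin 3), Literature.Analysis.FluidPDE.convect Q Q y + gradient Φ y = 0) ∧ (∀ g : EuclideanSpace ℝ (Fin 3) ≃ₗᵢ[ℝ]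 EuclideanSpace ℝ (Fin 3), Literature.Analysis.FluidPDE.IsOctahedralIsometry g → LinearMap.det (g.toLinearEquiv : EuclideanSpace ℝ (Fin 3) →ₗ[ℝ] EuclideanSpace ℝ (Fin 3)) = 1 → ∀ y : EuclideanSpace ℝ (Fin 3), Q (g y) = g (Q y) ∧ Φ (g y) = Φ y) ∧ (∀ s : Set (EuclideanSpace ℝ (Fin 3)), IsOpen s → s.Nonempty → ∃ y ∈ s, Q y ≠ 0) ∧ (∃ C δ : ℝ, 0 < δ ∧ ∀ y : EuclideanSpace ℝ (Fin 3), 1 ≤ ‖y‖ → ‖Q y - h y‖ + ‖y‖ * ‖fderiv ℝ Q y - fderiv ℝ h y‖ ≤ C * ‖y‖ ^ (-a - δ)) ∧ b < 0 ∧ ContDiff ℝ (⊤ : ℕ∞) W ∧ ContDiff ℝ (⊤ : ℕ∞) q ∧ Literature.Analysis.FluidPDE.VectorCalculus.IsDivFree W ∧ (∀ y : EuclideanSpace ℝ (Fin 3), Literature.Analysis.FluidPDE.convect Q W y + Literature.Analysis.FluidPDE.convect W Q y + gradient q y = Laplacian.laplacian Q y + b • (a • Q y + (fderiv ℝ Q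 y) y))

/-- item stmt-NavierStokesRegularity-19062 · crux · rank 3 · open · by planner
why it might fail: Shvydkoy conjectures NO nontrivial C¹ homogeneous solutions for α > −1 (arXiv:1510.03378 p.4) and proves none axisymmetric for 0 < α < 2 (Prop 5.1); DSS only removes Poincaré–Hopf forcing — measure preservation + negative mean pressure may still give a no-go; all numerics so far null.
sources: arXiv:1510.03378, arXiv:2305.05987, doi:10.1007/s00205-013-0630-z, arXiv:1409.4322, arXiv:2208.11109, Literature.Analysis.FluidPDE.shvydkoy2018_prop51_noAxisymmetric
[crux] (the wall; C1 ⇒ C2 by projection; staffed on its own because it is CAP-searchable and its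
negation is a printable theorem) ∃ a ∈ (1,3/2), l₀ > 1 and a C¹ steady Euler flow (h,P) on ℝ³∖0,
l₀-discretely self-similar of degrees (−a, −2a), O-equivariant, interacting (h vanishes identically
on no nonempty open set). Equivalent to a nontrivial O-equivariant C¹ solution of the reduced
first-order system on the compact quotient S²×(ℝ/(log l₀)ℤ). Sketch item C2. [difficulty: XL] -/
@[route_item "route-NavierStokesRegularity-ConeTipCollapse", crux]
def InteractingLogPeriodicCone : Prop :=
  ∃ (a l₀ : ℝ) (h : EuclideanSpace ℝ (Fin 3) → EuclideanSpace ℝ (Fin 3)) (P : EuclideanSpace ℝ (Fin 3) → ℝ), 1 < a ∧ a < 3 / 2 ∧ 1 < l₀ ∧ ContDiffOn ℝ 1 h {x : EuclideanSpace ℝ (Fin 3) | x ≠ 0} ∧ ContDiffOn ℝ 1 P {x : EuclideanSpace ℝ (Fin 3) | x ≠ 0} ∧ (∀ x : EuclideanSpace ℝ (Fin 3), x ≠ 0 → h (l₀ • x) = (l₀ ^ (-a)) • h x) ∧ (∀ x : EuclideanSpace ℝ (Fin 3), x ≠ 0 → P (l₀ • x) = l₀ ^ (-(2 * a)) * P x)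 ∧ (∀ x : EuclideanSpace ℝ (Fin 3), x ≠ 0 → Literature.Analysis.FluidPDE.VectorCalculus.divergence h x = 0) ∧ (∀ x : EuclideanSpace ℝ (Fin 3), x ≠ 0 → Literature.Analysis.FluidPDE.convect h h x + gradient P x = 0) ∧ (∀ g : EuclideanSpace ℝ (Fin 3) ≃ₗᵢ[ℝ] EuclideanSpace ℝ (Fin 3), Literature.Analysis.FluidPDE.IsOctahedralIsometry g → LinearMap.det (g.toLinearEquiv : EuclideanSpace ℝ (Fin 3) →ₗ[ℝ] EuclideanSpace ℝ (Fin 3)) = 1 → ∀ x : EuclideanSpace ℝ (Fin 3), h (g x) = g (h x) ∧ P (g x) = P x) ∧ (∀ s : Set (EuclideanSpace ℝ (Fin 3)), IsOpen s → s.Nonempty → ∃ x ∈ s, x ≠ 0 ∧ h x ≠ 0)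

/-- item stmt-NavierStokesRegularity-19063 · crux · rank 4 · open · by planner
why it might fail: anti-Grad: a smooth NON-symmetric steady Euler flow with a region of compact invariant tori may not exist at all (arXiv:2007.09103 Conj. 1; arXiv:2305.05987 p.12), relaxation may only reach non-smooth limits (arXiv:2208.11109 gives H¹/W^(k,p) limits, not C^∞), and the per-torus laws may force b > 0.
sources: arXiv:2208.11109, arXiv:2007.09103, arXiv:2305.05987, arXiv:2606.13462, ArnoldKhesin1998, Summits/NavierStokesRegularity/NavierStokesRegularity/Cruxes/CorrectorSolvable/KillMemo-stokes-carleman.md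
[crux] (the desingularisation-plus-corrector step in its weakest, existential form; binder of
`closes`) if SOME interacting O-equivariant log-periodic steady Euler cone exists in the window,
then some such cone is the tangent flow at infinity of a C^∞ O-equivariant steady Euler flow (Q,Φ)
on ℝ³ (nonzero on every nonempty open set, conical tail of order ‖y‖^(−a−δ)) that admits a
first-order collapse corrector (b < 0, W, q) — i.e. InteractingLogPeriodicCone → CollapsingResolver.
The birth skeleton separates it into ResolveOnly (equivariant desingularisation of the cone tip:
Voigt–MHD magnetic relaxation from the truncated cone, arXiv:2208.11109) and CorrectOnly
(solvability of (★★): per-torus energy/flux laws on the compact Bernoulli tori, Arnold structure +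
hyperbolic axis chains); both are ∀-form STUBS, never items. [deps: InteractingLogPeriodicCone,
CollapsingResolver] [difficulty: open-problem] -/
@[route_item "route-NavierStokesRegularity-ConeTipCollapse", crux]
def ConeToResolver : Prop :=
  InteractingLogPeriodicCone → CollapsingResolver

/-- item stmt-NavierStokesRegularity-19064 · crux · rank 5 · open · by planner
why it might fail: the number of unstable directions N(λ) of the linearisation grows without bound as t ↑ T (hyperbolic stagnation chains: Friedlander–Vishik essential spectrum), defeating epoch-by-epoch threshold selection; the β_a-similarity layer may radiate growing modes inward; pressure non-locality across zones.
sources: arXiv:1912.11009, arXiv:1702.05801, arXiv:0901.4286, arXiv:1901.09426, arXiv:2304.04045, arXiv:2602.17570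
[crux] (the NS construction given the skeleton; hardest technically, pointless before C1) for EVERY
skeleton (a, l₀, h, P, Q, Φ, b, W, q) satisfying the C1 clauses there are ν > 0, T > 0 and a
classical solution (u,p) of unforced Navier–Stokes on ℝ³×[0,T) which is MAXIMAL
(IsMaximalSmoothSolution ν 0 u p T), Leray–Hopf on [0,T] from its own datum, with u(0) rapidly
decaying, O-equivariant for every t ∈ [0,T), and such that λ(t)^a • u t (λ(t) • y) → Q(y) locally
uniformly in y as t ↑ T, λ(t) = √(2|b|ν(T−t)) (three-zone quasi-steady modulation: inner Q + εW, ε =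
νλ^(a−1) → 0; cone zone; β_a-similarity phase-slip layer at |x| ≍ (T−t)^(1/(1+a)); Schwartz
truncation; threshold control of the growing family of fast instabilities (H_spec)). Sketch item C3;
conclusion block verbatim the shape of AdiabaticEddy.FrozenEddyCollapse /
Literature.NS.blowup_assembly. [deps: CollapsingResolver] [difficulty: open-problem] -/
@[route_item "route-NavierStokesRegularity-ConeTipCollapse", crux]
def SkeletonRealisation : Prop :=
  ∀ (a l₀ : ℝ) (h : EuclideanSpace ℝ (Fin 3) → EuclideanSpace ℝ (Fin 3)) (P : EuclideanSpace ℝ (Fin 3) → ℝ) (Q : EuclideanSpace ℝ (Fin 3) → EuclideanSpace ℝ (Fin 3)) (Φ : EuclideanSpace ℝ (Fin 3) → ℝ) (b : ℝ) (W : EuclideanSpace ℝ (Fin 3) → EuclideanSpace ℝ (Fin 3)) (q : EuclideanSpace ℝ (Fin 3) → ℝ), (1 < a ∧ a < 3 / 2 ∧ 1 < l₀ ∧ ContDiffOn ℝ 1 h {x : EuclideanSpace ℝ (Fin 3) | x ≠ 0} ∧ ContDiffOn ℝ 1 P {x : EuclideanSpace ℝ (Fin 3) | x ≠ 0} ∧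 (∀ x : EuclideanSpace ℝ (Fin 3), x ≠ 0 → h (l₀ • x) = (l₀ ^ (-a)) • h x) ∧ (∀ x : EuclideanSpace ℝ (Fin 3), x ≠ 0 → P (l₀ • x) = l₀ ^ (-(2 * a)) * P x) ∧ (∀ x : EuclideanSpace ℝ (Fin 3), x ≠ 0 → Literature.Analysis.FluidPDE.VectorCalculus.divergence h x = 0) ∧ (∀ x : EuclideanSpace ℝ (Fin 3), x ≠ 0 → Literature.Analysis.FluidPDE.convect h h x + gradient P x = 0) ∧ (∀ g : EuclideanSpace ℝ (Fin 3) ≃ₗᵢ[ℝ] EuclideanSpace ℝ (Fin 3), Literature.Analysis.FluidPDE.IsOctahedralIsometry g → LinearMap.det (g.toLinearEquiv : EuclideanSpace ℝ (Fin 3) →ₗ[ℝ] EuclideanSpace ℝ (Fin 3)) = 1 → ∀ x : EuclideanSpace ℝ (Fin 3), h (g x) = g (h x) ∧ P (g x) = P x) ∧ (∀ s : Set (EuclideanSpace ℝ (Fin 3)), IsOpen s → s.Nonempty → ∃ x ∈ s, x ≠ 0 ∧ h x ≠ 0) ∧ ContDiff ℝ (⊤ : ℕ∞) Q ∧ ContDiff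 ℝ (⊤ : ℕ∞) Φ ∧ Literature.Analysis.FluidPDE.VectorCalculus.IsDivFree Q ∧ (∀ y : EuclideanSpace ℝ (Fin 3), Literature.Analysis.FluidPDE.convect Q Q y + gradient Φ y = 0) ∧ (∀ g : EuclideanSpace ℝ (Fin 3) ≃ₗᵢ[ℝ] EuclideanSpace ℝ (Fin 3), Literature.Analysis.FluidPDE.IsOctahedralIsometry g → LinearMap.det (g.toLinearEquiv : EuclideanSpace ℝ (Fin 3) →ₗ[ℝ] EuclideanSpace ℝ (Fin 3)) = 1 → ∀ y : EuclideanSpace ℝ (Fin 3), Q (g y) = g (Q y) ∧ Φ (g y) = Φ y) ∧ (∀ s : Set (EuclideanSpace ℝ (Fin 3)), IsOpen s → s.Nonempty → ∃ y ∈ s, Q y ≠ 0) ∧ (∃ C δ : ℝ, 0 < δ ∧ ∀ y : EuclideanSpace ℝ (Fin 3), 1 ≤ ‖y‖ → ‖Q y - h y‖ + ‖y‖ * ‖fderiv ℝ Q y - fderiv ℝ h y‖ ≤ C * ‖y‖ ^ (-a - δ)) ∧ b < 0 ∧ ContDiff ℝ (⊤ : ℕ∞) W ∧ ContDiff ℝ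 (⊤ : ℕ∞) q ∧ Literature.Analysis.FluidPDE.VectorCalculus.IsDivFree W ∧ (∀ y : EuclideanSpace ℝ (Fin 3), Literature.Analysis.FluidPDE.convect Q W y + Literature.Analysis.FluidPDE.convect W Q y + gradient q y = Laplacian.laplacian Q y + b • (a • Q y + (fderiv ℝ Q y) y))) → ∃ ν : ℝ, 0 < ν ∧ ∃ T : ℝ, 0 < T ∧ ∃ (u : ℝ → EuclideanSpace ℝ (Fin 3) → EuclideanSpace ℝ (Fin 3)) (p : ℝ → EuclideanSpace ℝ (Fin 3) → ℝ), Literature.Analysis.FluidPDE.IsMaximalSmoothSolution ν 0 u p T ∧ Literature.Analysis.FluidPDE.IsLerayHopfOn T ν 0 (u 0) u ∧ Literature.Analysis.FluidPDE.HasRapidSpatialDecay (u 0) ∧ (∀ t ∈ Set.Ico (0 : ℝ) T, ∀ g : EuclideanSpace ℝ (Fin 3) ≃ₗᵢ[ℝ] EuclideanSpace ℝ (Fin 3), Literature.Analysis.FluidPDE.IsOctahedralIsometry g → LinearMap.det (g.toLinearEquiv : EuclideanSpace ℝ (Fin 3) →ₗ[ℝ] EuclideanSpace ℝ (Fin 3))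 = 1 → ∀ x : EuclideanSpace ℝ (Fin 3), u t (g x) = g (u t x)) ∧ TendstoLocallyUniformly (fun (t : ℝ) (y : EuclideanSpace ℝ (Fin 3)) => (Real.sqrt (2 * |b| * ν * (T - t)) ^ a) • u t ((Real.sqrt (2 * |b| * ν * (T - t))) • y)) Q (nhdsWithin T (Set.Iio T))

/-- item stmt-NavierStokesRegularity-19065 · support · rank 9 · closed · proved by Summit.NavierStokesRegularity.NavierStokesRegularity.Theorems.coneTipCollapse_clayUniqueness_proof (prover) · by planner
sources: Tao2013LocalisationCompactness, EscauriazaSereginSverak2003, Summits/NavierStokesRegularity/NavierStokesRegularity/Theorems/AdiabaticEddyClayUniquenessCore.lean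
[support] (PROVED in tree: stmt-NavierStokesRegularity-0153,
`Summit.NavierStokesRegularity.NavierStokesRegularity.Theorems.blowup_clay_uniqueness` /
`adiabaticEddy_clayUniqueness_proof`; shared verbatim with Blowup.X5b, AdiabaticEddy.ClayUniqueness,
MirrorChamber.ClayUniqueness) a Fefferman class-(A) solution from a rapidly decaying datum agrees on
[0,T) with any classical Leray–Hopf solution from the same datum. Binder of `closes`; closed on
arrival. [difficulty: provable-now] -/
@[route_item "route-NavierStokesRegularity-ConeTipCollapse", crux]
def ClayUniqueness : Prop :=
  ∀ ν : ℝ, 0 < ν → ∀ (u₀ : EuclideanSpace ℝ (Fin 3) → EuclideanSpace ℝ (Fin 3)), Literature.Analysis.FluidPDE.HasRapidSpatialDecay u₀ → ∀ (u v : ℝ → EuclideanSpace ℝ (Fin 3) → EuclideanSpace ℝ (Fin 3)) (p q : ℝ → EuclideanSpace ℝ (Fin 3) → ℝ) (T : ℝ), 0 < T → Literature.Analysis.FluidPDE.IsSmoothOnHalfSpace u → Literature.Analysis.FluidPDE.IsSmoothOnHalfSpace p → Literature.Analysis.FluidPDE.IsNavierStokesSolution ν 0 u₀ u p → Literature.Analysis.FluidPDE.HasBoundedEnergy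 u → Literature.Analysis.FluidPDE.IsClassicalNSSolutionOn (Set.Ico 0 T) ν 0 v q → Literature.Analysis.FluidPDE.IsLerayHopfOn T ν 0 u₀ v → v 0 = u₀ → ∀ t ∈ Set.Ico 0 T, u t = v t

-- `ClayUniqueness` holds: proved by `Summit.NavierStokesRegularity.NavierStokesRegularity.Theorems.coneTipCollapse_clayUniqueness_proof` (its module imports this route file, so no `_holds` link can be stated here).

/-- item stmt-NavierStokesRegularity-19066 · assembly · rank 1 · closed · proved by Summit.NavierStokesRegularity.NavierStokesRegularity.Theorems.coneTipCollapse_assembly_proof (prover) · by planner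
sources: Summits/NavierStokesRegularity/NavierStokesRegularity/Theorems/BlowupAssembly.lean, BealeKatoMajda1984
[assembly] CollapsingResolver → SkeletonRealisation → ClayUniqueness → ¬ NavierStokesRegularity (the
mathematical assembly; `closes` feeds it ConeToResolver applied to InteractingLogPeriodicCone). -/
@[route_item "route-NavierStokesRegularity-ConeTipCollapse"]
def Assembly : Prop :=
  CollapsingResolver → SkeletonRealisation → ClayUniqueness → ¬ _root_.NavierStokesRegularity

-- `Assembly` holds: proved by `Summit.NavierStokesRegularity.NavierStokesRegularity.Theorems.coneTipCollapse_assembly_proof` (its module imports this route file, so no `_holds` link can be stated here).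

/-! D-0027 §2.1 — DECIDING THEOREM (planner-authored via `route open/edit --closes-file`; by planner-type-9c17c6396d-0 2026-08-17T18:14:56Z):
its hypotheses are this route's items and its conclusion the sub-problem Statement (glue_lint), and it elaborates with this file. -/

@[closes "route-NavierStokesRegularity-ConeTipCollapse"] theorem closes (h₂ : InteractingLogPeriodicCone) (hR : ConeToResolver) (h₃ : SkeletonRealisation) (hU : ClayUniqueness) : ¬ _root_.NavierStokesRegularity := by
  have h₁ : CollapsingResolver := hR h₂
  have hA : Assembly := by
    rintro ⟨a, l₀, h, P, Q, Φ, b, W, q, hD⟩ h3 hu hReg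
    obtain ⟨ν, hν, T, hT, u, p, ⟨hcl, hmax⟩, hLH, hdec, -, -⟩ := h3 a l₀ h P Q Φ b W q hD
    have h0 : (0 : ℝ) ∈ Set.Ico 0 T := ⟨le_rfl, hT⟩
    obtain ⟨u', p', hu', hp', hns, hbe⟩ :=
      hReg ν hν (u 0) (hcl.contDiff_velocity h0) (hcl.divFree 0 h0) hdec
    have heq : ∀ t ∈ Set.Ico 0 T, u' t = u t :=
      hu ν hν (u 0) hdec u' u p' p T hT hu' hp' hns hbe hcl hLH rfl
    have hcl' : Literature.Analysis.FluidPDE.IsClassicalNSSolutionOn (Set.Ici 0) ν 0 u' p' :=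
      ⟨hu', hp', fun t ht x => hns.momentum t ht x, fun t ht => hns.divFree t ht⟩
    refine hmax ⟨T + 1, by linarith, u', p', ?_, heq⟩
    exact hcl'.mono (fun t ht => ht.1) (uniqueDiffOn_Ico 0 (T + 1))
  exact hA h₁ h₃ hU

end Summit.NavierStokesRegularity.NavierStokesRegularity.Theses.ConeTipCollapse
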